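import Summits.NavierStokesRegularity.NavierStokesRegularity.Theorems.ClockStretchingLawClockCeilingFarPastVorticityFloor
import Summits.NavierStokesRegularity.NavierStokesRegularity.Theorems.ClockStretchingLawClockCeilingOpenSetVorticityLiouville
import Summits.NavierStokesRegularity.NavierStokesRegularity.Theorems.SqueezeCycleSingularZoomExtraction
import Literature.Analysis.FluidPDE.TaoEnstrophyLocalisation
import Literature.Analysis.FluidPDE.TypeIAncientMild
import HarnessLib

/-!
# Route ClockStretchingLaw, crux `ClockCeiling` (stmt-NavierStokesRegularity-10570), line `registered` —
# structural law: VELOCITY CONCENTRATION FORCES VORTICITY CONCENTRATION at the parabolic scale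

`stub_velocityForcesVorticity`: for every Type-I constant `C` and every level `θ > 0` there are
`R = R(C, θ) > 0` and `η = η(C, θ) > 0` such that for EVERY element `u` of the Type-I ancient mild
class `A_C` (`IsTypeIAncientMild C u`: jointly smooth on `t < 0`, divergence free, KNSS/Oseen mild
between all pairs `s < t < 0`, `‖u(t,x)‖ ≤ C/√(−t)`), every `t < 0` and every `x`:
if `√(−t)‖u(t, x)‖ ≥ θ` then some `x'` with `‖x' − x‖ < R√(−t)` has `(−t)‖curl u(t, x')‖ ≥ η`.
The law is uniform over the class (no "nonzero" hypothesis) and scale invariant; the constants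
come from compactness and are not explicit. It subsumes the far-past vorticity floor
`stub_farPastVorticityFloor`.

## Proof (contradiction + zoom + compactness)

If not, for `R = k+1`, `η = 1/(k+1)` there are `u_k ∈ A_C`, `t_k < 0`, `x_k` with
`√(−t_k)‖u_k(t_k, x_k)‖ ≥ θ` but `(−t_k)‖curl u_k(t_k, ·)‖ < 1/(k+1)` on the ball
`B(x_k, (k+1)√(−t_k))`. The Navier–Stokes zoom `v_k(s, y) = c_k u_k(c_k² s, x_k + c_k y)`,
`c_k = √(−t_k)`, is again in `A_C` with `‖v_k(−1, 0)‖ = √(−t_k)‖u_k(t_k, x_k)‖ ≥ θ` and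
`‖curl v_k(−1, y)‖ = (−t_k)‖curl u_k(t_k, x_k + c_k y)‖ < 1/(k+1)` for `‖y‖ < k+1`
(`farPastVorticityFloor_zoom`). KNSS compactness of the class on growing windows
(`exists_tendsto_of_typeI_seq_Ioo`) extracts a limit `W ∈ A_C` with pointwise convergence of values
and gradients at `t = −1`: `‖W(−1, 0)‖ ≥ θ > 0` while `curl W(−1, ·) ≡ 0` (every `y` is eventually
inside the ball of radius `φ(j)+1`; continuity of `curlCLM`). One irrotational slice kills a class
element (`irrotationalSliceLiouville`, KNSS 2009 Lemma 3.1 + Remark 6.1): `W ≡ 0` — contradiction.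

## References

* G. Koch, N. Nadirashvili, G. Seregin, V. Šverák, *Liouville theorems for the Navier–Stokes
  equations and applications*, Acta Math. 203 (2009) 83–105 = arXiv:0709.3599, §1 (1.2),
  Lemma 3.1, Prop. 4.1, Remark 6.1. [KochNadirashviliSereginSverak2009]
-/

noncomputable section

-- the summit and its single sub-problem share the name (CONVENTIONS §1), as in every Theorems file
set_option linter.dupNamespace false

namespace Summit.NavierStokesRegularity.NavierStokesRegularity.Theorems

open MeasureTheory Set Function Filter Topology
open Literature.Analysis Literature.Analysis.FluidPDE

section VelocityForcesVorticity

/-- **Velocity concentration forces vorticity concentration at the parabolic scale (uniformly over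
the Type-I ancient mild class).** For every `C` and `θ > 0` there are `R > 0` and `η > 0` such that
for every `u ∈ A_C`, every `t < 0` and every `x` with `θ ≤ √(−t)‖u(t, x)‖` some point `x'` of the
ball `B(x, R√(−t))` has `η ≤ (−t)‖curl u(t, x')‖`. By contradiction: zoom the violating data to
unit scale (`farPastVorticityFloor_zoom`), extract a limit in the class
(`exists_tendsto_of_typeI_seq_Ioo`) which has norm `≥ θ` at `(−1, 0)` but is irrotational at
`t = −1`, against `irrotationalSliceLiouville`.
[cite: KochNadirashviliSereginSverak2009, Lemma 3.1, Prop. 4.1 and Remark 6.1 (arXiv:0709.3599)] -/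
theorem velocityForcesVorticity (C : ℝ) {θ : ℝ} (hθ : 0 < θ) :
    ∃ R > 0, ∃ η > 0, ∀ u : ℝ → EuclideanSpace ℝ (Fin 3) → EuclideanSpace ℝ (Fin 3),
      IsTypeIAncientMild C u → ∀ t < 0, ∀ x : EuclideanSpace ℝ (Fin 3),
        θ ≤ Real.sqrt (-t) * ‖u t x‖ →
          ∃ x' ∈ Metric.ball x (R * Real.sqrt (-t)), η ≤ (-t) * ‖curl (u t) x'‖ := by
  by_contra h
  push Not at h
  -- violating data at radius `n+1` and vorticity level `1/(n+1)`
  have hseq : ∀ n : ℕ, ∃ u : ℝ → EuclideanSpace ℝ (Fin 3) → EuclideanSpace ℝ (Fin 3),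
      IsTypeIAncientMild C u ∧ ∃ t, t < 0 ∧ ∃ x : EuclideanSpace ℝ (Fin 3),
        θ ≤ Real.sqrt (-t) * ‖u t x‖ ∧
        ∀ x' ∈ Metric.ball x (((n : ℝ) + 1) * Real.sqrt (-t)),
          (-t) * ‖curl (u t) x'‖ < 1 / ((n : ℝ) + 1) :=
    fun n => h _ (Nat.cast_add_one_pos n) _ Nat.one_div_pos_of_nat
  choose u hu t ht x hx hsm using hseq
  -- zoom to unit scale around the concentration points
  choose v hv hv0 hvcurl using fun n => farPastVorticityFloor_zoom (hu n) (ht n) (x n)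
  -- compactness on the growing windows `(-(k+1), 0)`
  set A : ℕ → ℝ := fun k => -((k : ℝ) + 1)
  have hAt : Tendsto A atTop atBot :=
    tendsto_neg_atTop_atBot.comp (tendsto_natCast_atTop_atTop.atTop_add tendsto_const_nhds)
  have hcont : ∀ k, ContinuousOn (uncurry (v k)) (Ioo (A k) 0 ×ˢ univ) := fun k =>
    (hv k).continuousOn_uncurry.mono (prod_mono (fun t ht => ht.2) subset_rfl)
  have hdivw : ∀ k, ∀ t ∈ Ioo (A k) 0, IsWeaklyDivFree (v k t) := fun k t ht =>
    (hv k).isWeaklyDivFree ht.2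
  have hmild : ∀ k, ∀ s t : ℝ, A k < s → s < t → t < 0 → ∀ x,
      v k t x = UnboundedOperators.heatExtension (v k s) (t - s) x -
        oseenDuhamel 1 s (v k) (v k) t x :=
    fun k s t _ hst ht x => (hv k).mild_eq_heatExtension hst ht x
  have hI : ∀ k, ∀ t ∈ Ioo (A k) 0, ∀ x, ‖v k t x‖ ≤ C / Real.sqrt (-t) := fun k t ht x =>
    (hv k).norm_le ht.2 x
  obtain ⟨φ, hφ, W, hW, hpt, hptG, -, -⟩ :=
    exists_tendsto_of_typeI_seq_Ioo C hAt hcont hdivw hmild hI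
  -- the limit has norm `≥ θ` at `(-1, 0)`
  have hW0 : θ ≤ ‖W (-1) 0‖ := by
    refine ge_of_tendsto (hpt (-1) (by norm_num) 0).norm (Eventually.of_forall fun j => ?_)
    rw [hv0 (φ j)]
    exact hx (φ j)
  -- its vorticity at `-1` is the limit of the vorticities, hence zero
  have hcurlW : ∀ y, curl (W (-1)) y = 0 := by
    intro y
    have hconv : Tendsto (fun j => curl (v (φ j) (-1)) y) atTop (𝓝 (curl (W (-1)) y)) := by
      simp only [curl_eq_curlCLM]
      exact (curlCLM.continuous.tendsto _).comp (hptG (-1) (by norm_num) y)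
    have hb : Tendsto (fun j : ℕ => 1 / ((φ j : ℝ) + 1)) atTop (𝓝 0) :=
      (tendsto_one_div_add_atTop_nhds_zero_nat (𝕜 := ℝ)).comp hφ.tendsto_atTop
    -- `y` is eventually inside the zoomed ball of radius `φ j + 1`
    have hev : ∀ᶠ j : ℕ in atTop, ‖y‖ < (φ j : ℝ) + 1 := by
      obtain ⟨N, hN⟩ := exists_nat_gt ‖y‖
      refine (eventually_ge_atTop N).mono fun j hj => hN.trans ?_
      exact_mod_cast Nat.lt_succ_of_le (hj.trans (hφ.le_apply))
    have hle : ‖curl (W (-1)) y‖ ≤ 0 :=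
      le_of_tendsto_of_tendsto hconv.norm hb (hev.mono fun j hj => by
        have hc : 0 < Real.sqrt (-t (φ j)) := Real.sqrt_pos.2 (neg_pos.2 (ht (φ j)))
        have hmem : x (φ j) + Real.sqrt (-t (φ j)) • y ∈
            Metric.ball (x (φ j)) (((φ j : ℝ) + 1) * Real.sqrt (-t (φ j))) := by
          rw [mem_ball_iff_norm, add_sub_cancel_left, norm_smul, Real.norm_of_nonneg hc.le,
            mul_comm]
          exact mul_lt_mul_of_pos_right hj hc
        have := hsm (φ j) _ hmem
        rw [← hvcurl (φ j)] at this
        exact this.le)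
    exact norm_le_zero_iff.1 hle
  -- one irrotational slice kills the limit: contradiction with the level `θ` at `(-1, 0)`
  have hWz : W (-1) 0 = 0 := irrotationalSliceLiouville hW (by norm_num : (-1 : ℝ) < 0) hcurlW
    (-1) (by norm_num) 0
  rw [hWz, norm_zero] at hW0
  exact absurd hW0 (not_le.2 hθ)

end VelocityForcesVorticity

/-- **Stub `stub_velocityForcesVorticity` (crux stmt-NavierStokesRegularity-10570, line `registered`,
structural law of the class)**: VELOCITY CONCENTRATION FORCES VORTICITY CONCENTRATION at the
parabolic scale, uniformly over the Type-I ancient mild class — for every `C` and `θ > 0` there are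
`R > 0`, `η > 0` such that for every `u` with `IsTypeIAncientMild C u`, every `t < 0` and every `x`
with `θ ≤ √(−t)‖u(t, x)‖`, some `x' ∈ B(x, R√(−t))` has `η ≤ (−t)‖curl u(t, x')‖`
(zoom + KNSS compactness + one irrotational slice kills a class element; `velocityForcesVorticity`).
[cite: KochNadirashviliSereginSverak2009, Lemma 3.1, Prop. 4.1 and Remark 6.1 (arXiv:0709.3599)] -/
theorem stub_velocityForcesVorticity : ∀ (C θ : ℝ), 0 < θ → ∃ R > 0, ∃ η > 0, ∀ u : ℝ → EuclideanSpace ℝ (Fin 3) → EuclideanSpace ℝ (Fin 3), Literature.Analysis.FluidPDE.IsTypeIAncientMild C u → ∀ t < 0, ∀ x : EuclideanSpace ℝ (Fin 3), θ ≤ Real.sqrt (-t) * ‖u t x‖ → ∃ x' ∈ Metric.ball x (R * Real.sqrt (-t)), η ≤ (-t) * ‖Literature.Analysis.FluidPDE.curl (u t) x'‖ :=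
  fun C _ hθ => velocityForcesVorticity C hθ

end Summit.NavierStokesRegularity.NavierStokesRegularity.Theorems

end
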